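import Summits.ABC.IUTFork.Repair.CandMochizukiSlides3115
import Summits.ABC.IUTFork.Cor312StatementBridges
import Summits.ABC.IUTFork.Cor312StatementPilotNouns
import Summits.ABC.IUTFork.Cor312IdentifiedCopies
import HarnessLib

/-!
# D-0123(C) IUT REPAIR-CATALOGUE (rung LADDER-ABC:A2), sweep row L3-58 (abc-iut-rcat-lit-3) — the public Lean repository
# `lana-agents/iut` (2026-07-20…27; «a project-owner-specified variant of IUT III, Corollary 3.12 … a specification /
# formal-statement project only»): KERNEL-CLOSE cell over OUR interface (tester abc-iut-rcat-tst-10, RC-652 tester cell)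

Record file (D-0012) of the abc-iut cell; PROOF-ONLY (no new definition, no new hypothesis, no instance, no notation). TAKES NO
SIDE on [IUTchIII] Cor. 3.12 / [IUTchIV] Thm. 1.10, on any author, or on the external repository (D-0045); nothing here asserts abc
proved or refuted. The external code is DATA, read first-hand in the cell's archived snapshot
(HOME/abc-iut-rcat-lit-3/web/gh/lana-agents__iut/, zip sha16 76c947327170a329); nothing of it is imported or transcribed as a fact.

WHAT THE REPOSITORY TYPES (located, its `Iut/Cor312/Statement.lean` l. 89–97): `Corollary312Variant X : Prop := X.qPilot.lhs ≤
X.rhsData.rhs`, an UNPROVED `Prop`-valued definition («deliberately left without proof and without axioms», l. 32–33), with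
`lhs := −(log q)/(2ℓ)` an explicit arithmetic degree of the bad-place Tate parameters (`LeftHandSide.lean` l. 81–93) and `rhs :=`
the procession-normalised log-volume of the capsule-wise holomorphic hull of a theta-pilot REGION THAT IS AN INPUT FIELD
(`RightHandSide.lean` l. 83 `thetaPilot : ∀ i, container.AdmissibleRegion i`, l. 106 `rhs := R.vol.processionVol R.thetaHull`;
l. 25–28 «the multiradial algorithm that produces it is out of scope … so the region is an explicit input»); finiteness of
`−|log(Θ)|` is likewise an input (`thetaPilot_hullAdmissible`, total `ℝ`-valued volumes, `LogVolume.lean` l. 17–25).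

WHAT THIS FILE RECORDS over the frozen vocabulary `Cor312.Setting` (the "input-region form" below is the repository's SHAPE written
out in our nouns — `−|log(q)| ≤` procession-normalised `Σ_{v_ℚ}` log-volume of the hull of a GIVEN family of regions — as an explicit
expression, not as a new definition):
* (a) `statement_iff_thetaFinite_and_inputForm_genuine`: with the GENUINE input (the union of the possible images of the Θ-pilot,
  `⋃₀ possibleImages`) the input-region form, together with the finiteness conjunct, IS `Cor312.Setting.Statement` — a typed twin of
  the TARGET at the volume level, nothing more;
* (b) `inputForm_q_eq_negLogQ` / `inputForm_q_holds`: with the input := the q-pilot's own images (hull-sets) the form holds in EVERY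
  setting (both sides are `−|log(q)|`);
* (c) `not_inputForm_genuine_pinnedSetting`: with the genuine input it FAILS at abc-iut-w4-d101's pinned countermodel of record
  (`Cor312Vol.PinnedWitness.pinnedSetting`, p419720), where typed Thm. 3.11, the bridge hypotheses, `|log(q)| > 0` and `ThetaFinite` hold;
* (d) `inputRegion_form_not_determined`: hence, with the Θ-region an INPUT as the repository types it, the inequality is not a
  property of the typed situation: one and the same typed setting makes it true for one admissible input and false for another —
  the kernel form, at our interface, of the repository's own charter sentence that the algorithm producing the region is out of scope.
As a REPAIR of «3.11 ⟹ 3.12» the repository offers nothing to instantiate (0 declarations take Theorem-3.11-type premises); this file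
therefore closes no item and kills no reading; it fills one catalogue cell. typed ≠ proved; located ≠ adjudicated; standard axioms only.
-/

noncomputable section

namespace Summit.ABC.IUTFork.Repair.RcatLanaAgentsIut

open Thm311 Cor312 Cor312.Checks Cor312.IdentifiedNonVacuity Cor312Vol Literature.IUT.LogThetaLattice
open Cor312Vol.NaiveWitness Cor312Vol.PinnedWitness
open Cor312.Setting (labelSucc)

variable {T : ThetaIndex}

section Genuine

variable {S : LatticeSituation T} (P : Cor312.Setting S.toSituation)

/-- Under `ThetaFinite`, the displayed real number `−|log(Θ)|` of the setting equals the "input-region form" right-hand side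
evaluated at the GENUINE input `⋃₀ possibleImages` (the hull of that union is `thetaHull` by definition, and every local term is
the real log-volume of that hull). [folklore] -/
theorem genuine_rhs_eq (h : P.ThetaFinite) :
    (processionNormalized fun i : Fin T.lstar => ∑ᶠ vQ : T.VQ, (P.thetaLocal (labelSucc i) vQ).untopD 0) =
      processionNormalized fun i : Fin T.lstar =>
        ∑ᶠ vQ : T.VQ, (S.toSituation.D P.n).logvol (labelSucc i) vQ
          ((P.frame (labelSucc i) vQ).hull (⋃₀ P.possibleImages (labelSucc i) vQ)) := by
  congr 1
  funext i
  refine finsum_congr fun vQ => ?_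
  rw [P.thetaLocal_untopD (P.hullDefined_of_thetaFinite h i vQ)]
  rfl

/-- **(a) TYPED TWIN OF THE TARGET.** `Cor312.Setting.Statement` ⟺ `ThetaFinite` ∧ (the input-region form at the GENUINE input
`⋃₀ possibleImages`): the repository's shape `lhs ≤ processionVol (hull thetaPilot)` with finiteness supplied separately, read with the
Θ-region := the union of the possible images of the Θ-pilot, is exactly the printed conclusion as typed in the tree. [folklore] -/
theorem statement_iff_thetaFinite_and_inputForm_genuine :
    P.Statement ↔ P.ThetaFinite ∧
      P.negLogQ ≤ processionNormalized fun i : Fin T.lstar =>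
        ∑ᶠ vQ : T.VQ, (S.toSituation.D P.n).logvol (labelSucc i) vQ
          ((P.frame (labelSucc i) vQ).hull (⋃₀ P.possibleImages (labelSucc i) vQ)) := by
  constructor
  · intro hs
    have h : P.ThetaFinite := P.thetaFinite_of_statement hs
    refine ⟨h, ?_⟩
    rw [← genuine_rhs_eq P h]
    exact (P.statement_iff_of_thetaFinite h).1 hs
  · rintro ⟨h, hle⟩
    rw [← genuine_rhs_eq P h] at hle
    exact (P.statement_iff_of_thetaFinite h).2 hle

/-- Under `ThetaFinite` alone, the input-region form at the genuine input ⟺ the Statement. [folklore] -/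
theorem inputForm_genuine_iff_statement (h : P.ThetaFinite) :
    (P.negLogQ ≤ processionNormalized fun i : Fin T.lstar =>
        ∑ᶠ vQ : T.VQ, (S.toSituation.D P.n).logvol (labelSucc i) vQ
          ((P.frame (labelSucc i) vQ).hull (⋃₀ P.possibleImages (labelSucc i) vQ))) ↔ P.Statement := by
  rw [statement_iff_thetaFinite_and_inputForm_genuine]
  exact ⟨fun hle => ⟨h, hle⟩, fun hs => hs.2⟩

/-- Under `ThetaFinite` the genuine input's hulls at the labels in `𝔽_l^⋇` are hull-sets too (`HullDefined`, `hull_mem_of_hasHull`).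
[folklore] -/
theorem hull_genuine_mem (h : P.ThetaFinite) (i : Fin T.lstar) (vQ : T.VQ) :
    (P.frame (labelSucc i) vQ).hull (⋃₀ P.possibleImages (labelSucc i) vQ) ∈ (P.frame (labelSucc i) vQ).Hul :=
  (P.frame (labelSucc i) vQ).hull_mem_of_hasHull (P.hullDefined_of_thetaFinite h i vQ).1
    (P.hullDefined_of_thetaFinite h i vQ).2

end Genuine

section QInput

variable {S : Situation T} (P : Cor312.Setting S)

/-- The q-pilot's image at `(j, v_ℚ)` is a hull-set (the field `qRegion_mem`, restated for `qRegion`). [folklore] -/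
theorem qRegion_mem_hul (j : T.Label) (vQ : T.VQ) : P.qRegion j vQ ∈ (P.frame j vQ).Hul := P.qRegion_mem j vQ

/-- **(b) THE q-INPUT.** With the input := the q-pilot's own images (hull-sets, `qRegion_mem`, so each is its own hull) the
input-region right-hand side IS `−|log(q)|`. [folklore] -/
theorem inputForm_q_eq_negLogQ :
    (processionNormalized fun i : Fin T.lstar =>
        ∑ᶠ vQ : T.VQ, (S.D P.n).logvol (labelSucc i) vQ
          ((P.frame (labelSucc i) vQ).hull (P.qRegion (labelSucc i) vQ))) = P.negLogQ := by
  unfold Cor312.Setting.negLogQ Cor312.Setting.qLocal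
  congr 1
  funext i
  refine finsum_congr fun vQ => ?_
  rw [(P.frame (labelSucc i) vQ).hull_eq_self_of_mem (qRegion_mem_hul P (labelSucc i) vQ)]

/-- … so with the q-input the form HOLDS in EVERY setting (it reads `−|log(q)| ≤ −|log(q)|`). [folklore] -/
theorem inputForm_q_holds :
    P.negLogQ ≤ processionNormalized fun i : Fin T.lstar =>
        ∑ᶠ vQ : T.VQ, (S.D P.n).logvol (labelSucc i) vQ
          ((P.frame (labelSucc i) vQ).hull (P.qRegion (labelSucc i) vQ)) :=
  le_of_eq (inputForm_q_eq_negLogQ P).symm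

/-- The q-input's hulls are hull-sets (admissible inputs in the repository's sense). [folklore] -/
theorem hull_qRegion_mem (j : T.Label) (vQ : T.VQ) :
    (P.frame j vQ).hull (P.qRegion j vQ) ∈ (P.frame j vQ).Hul := by
  rw [(P.frame j vQ).hull_eq_self_of_mem (qRegion_mem_hul P j vQ)]
  exact qRegion_mem_hul P j vQ

end QInput

/-! ## At the pinned countermodel of record (every prime `p`) -/

section Pinned

variable (p : ℕ)

/-- `ThetaFinite` HOLDS at the pinned countermodel (a bridge hypothesis there, p419720). [folklore] -/
theorem thetaFinite_pinnedSetting [Fact p.Prime] : (pinnedSetting p).ThetaFinite := (pinnedSetting_bridgeHyps p).finite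

/-- **(c)** With the GENUINE input the input-region form FAILS at the pinned countermodel (the Statement fails there while
`ThetaFinite` holds). [folklore] -/
theorem not_inputForm_genuine_pinnedSetting [Fact p.Prime] :
    ¬ ((pinnedSetting p).negLogQ ≤ processionNormalized fun i : Fin toyIndex.lstar =>
        ∑ᶠ vQ : toyIndex.VQ, ((naiveSituation p).D (pinnedSetting p).n).logvol (labelSucc i) vQ
          (((pinnedSetting p).frame (labelSucc i) vQ).hull (⋃₀ (pinnedSetting p).possibleImages (labelSucc i) vQ))) :=
  fun hle => pinnedSetting_not_statement p
    ((inputForm_genuine_iff_statement (S := (naiveFull p).toLatticeSituation) (pinnedSetting p)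
      (thetaFinite_pinnedSetting p)).1 hle)

/-- … while with the q-INPUT it holds there (as everywhere). [folklore] -/
theorem inputForm_q_pinnedSetting :
    (pinnedSetting p).negLogQ ≤ processionNormalized fun i : Fin toyIndex.lstar =>
        ∑ᶠ vQ : toyIndex.VQ, ((naiveSituation p).D (pinnedSetting p).n).logvol (labelSucc i) vQ
          (((pinnedSetting p).frame (labelSucc i) vQ).hull ((pinnedSetting p).qRegion (labelSucc i) vQ)) :=
  inputForm_q_holds (pinnedSetting p)

end Pinned

/-- **(d) WITH THE Θ-REGION AN INPUT, THE INEQUALITY IS NOT DETERMINED BY THE TYPED SITUATION (packaged, `p = 2`).** There is a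
setting carrying typed Theorem 3.11 (i)–(iii) (`FullSituation.Statement`), the bridge hypotheses, `|log(q)| > 0` and `ThetaFinite`,
and two input families `X`, `Y` of regions whose hulls at every `(j, v_ℚ)`, `j ∈ 𝔽_l^⋇`, are hull-sets (admissible), such that the
input-region form `−|log(q)| ≤` procession-normalised hull-volume of the input HOLDS for `X` (the q-pilot's images) and FAILS for `Y`
(the genuine union of possible images of the Θ-pilot). So a statement of the repository's shape, with the region supplied as data,
is true or false according to the datum and carries no content about «3.11 ⟹ 3.12» until the region is tied to the Θ-pilot by the
multiradial algorithm — which the repository declares out of scope and our chain types as the glue `thetaRegionOf` + (Ind1,2,3).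
An assembly of (b), (c) at the countermodel of record; no judgement on print or on the repository. [folklore] -/
theorem inputRegion_form_not_determined :
    ∃ (T : ThetaIndex) (F : FullSituation T) (P : Cor312.Setting F.toLatticeSituation.toSituation)
      (X Y : ∀ (j : T.Label) (vQ : T.VQ), Set (F.L.Packet j vQ)),
      F.Statement ∧ BridgeHyps P ∧ P.AbsLogQPos ∧ P.ThetaFinite ∧
      (∀ (i : Fin T.lstar) (vQ : T.VQ), (P.frame (labelSucc i) vQ).hull (X (labelSucc i) vQ) ∈ (P.frame (labelSucc i) vQ).Hul) ∧
      (∀ (i : Fin T.lstar) (vQ : T.VQ), (P.frame (labelSucc i) vQ).hull (Y (labelSucc i) vQ) ∈ (P.frame (labelSucc i) vQ).Hul) ∧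
      (P.negLogQ ≤ processionNormalized fun i : Fin T.lstar =>
        ∑ᶠ vQ : T.VQ, (F.toLatticeSituation.toSituation.D P.n).logvol (labelSucc i) vQ
          ((P.frame (labelSucc i) vQ).hull (X (labelSucc i) vQ))) ∧
      ¬ (P.negLogQ ≤ processionNormalized fun i : Fin T.lstar =>
        ∑ᶠ vQ : T.VQ, (F.toLatticeSituation.toSituation.D P.n).logvol (labelSucc i) vQ
          ((P.frame (labelSucc i) vQ).hull (Y (labelSucc i) vQ))) := by
  haveI : Fact (Nat.Prime 2) := ⟨Nat.prime_two⟩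
  exact ⟨toyIndex, naiveFull 2, pinnedSetting 2, (pinnedSetting 2).qRegion, fun j vQ => ⋃₀ (pinnedSetting 2).possibleImages j vQ,
    naiveFull_statement 2, pinnedSetting_bridgeHyps 2, pinnedSetting_absLogQPos 2, thetaFinite_pinnedSetting 2,
    fun i vQ => hull_qRegion_mem (pinnedSetting 2) (labelSucc i) vQ,
    fun i vQ => hull_genuine_mem (S := (naiveFull 2).toLatticeSituation) (pinnedSetting 2) (thetaFinite_pinnedSetting 2) i vQ,
    inputForm_q_pinnedSetting 2, not_inputForm_genuine_pinnedSetting 2⟩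

end Summit.ABC.IUTFork.Repair.RcatLanaAgentsIut

end
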